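import Summits.BirchSwinnertonDyer.BirchSwinnertonDyer.Theorems.ResidualThetaTransportAtTwoRlfTwistedLocalKummerCard
import Summits.BirchSwinnertonDyer.BirchSwinnertonDyer.Theorems.ThetaPartnerAtTwoSignedKatoUpToAtTwoLayerPairingModDefs
import Literature.NumberTheory.GaloisRepresentations.ContinuousCorestriction
import HarnessLib

/-!
# Route `ResidualThetaTransportAtTwo` (RTT P6, item stmt-BirchSwinnertonDyer-23110, road T), H-PLUSDUAL / ISO brick (C):
# corestriction FROM THE LAYER `U_J = Gal(ℚ̄_v/ℚ_{v,J})` of witness classes lands in the twisted signed local Kummer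
# condition `L_u`, with the TWISTED NORM of the witness point

Width seat `bsd-wall-tp2-p2x-w2` g16 (cell `bsd-wall`), for the LEAD `bsd-wall-tp2-p2x` g12. HONEST FRAMING: THEOREMS ONLY
(no definition, no named fact, no instance, no `sorry`); closes no item; BSD is NOT proved by any of this.

Setting (as in `…RlfTwistedLocalKummerWitness/Card`): `W/ℚ`, `κ` a `ℤ₂`-extension of `ℚ`, `v` a place, `ℚ_v = v.adicCompletion ℚ`,
`N = Gal(ℚ̄_v/ℚ_{v,∞}) = localSubgroup (ker κ) ℚ_v`, `U_J = LayerPairing.layerGroup κ v J = Gal(ℚ̄_v/ℚ_{v,J})` (the K3 layer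
group), `A = ⋃ₙ E⁺(ℚ_{v,n})`, `M_u = E[2^J](χ_u)` the twisted torsion module (`twistedTorsionGaloisModule`), and
`L_u = twistedTorsionLocalKummer 2 κ J u hu ℚ_v A ≤ H¹(ℚ_v, M_u)`. B. D. Kim's proof of the twisted `±`-duality
(Compositio 143 (2007), Prop. 4.11 with Prop. 3.15: «`Cor_𝔭(H^n_{𝔭,P}[𝔪^k]) = H^0_{𝔭,P}[𝔪^k]`») descends to the layer where
the twist dies. Here:

* §1 `kerLocal_le_layerGroup` (`N ≤ U_J`), `twistedTorsion_restrictField_apply_of_mem_layerGroup` — ON `U_J` THE TWIST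
  `χ_u` IS INVISIBLE on `E[2^J]` (`galoisTwist_apply_of_mem_layerSubgroup`: `u^{κ(σ) mod 2^J} = u^0`), so a `U_J`-cocycle of
  `M_u|` is the same thing as a `U_J`-cocycle of `E[2^J]|` (`exists_untwist_layerCocycle`, `exists_twist_layerCocycle`);
* §2 **`cores_mem_twistedTorsionLocalKummer_of_layerWitness`** — for a continuous `U_J`-cocycle `ψ` of `M_u|_{Γ_{ℚ_v}}` with an
  `A`-WITNESS `(Q, k)` on `N` (`ψ(τ) = τQ − Q` on points for `τ ∈ N`, `2^k Q ∈ A`), the corestriction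
  `cor_{U_J}^{Γ_{ℚ_v}} [ψ] ∈ H¹(ℚ_v, M_u)` lies in `L_u`, with witness point the TWISTED NORM
  `Q' = Σ_{x ∈ Γ_v/U_J} u^{κ(s x) mod 2^J} • s(x) • Q` for any system of representatives `s` (transfer formula: for `τ ∈ N ⊴ Γ_v`
  every coset is fixed, the Schreier elements are `s(x)⁻¹ τ s(x) ∈ N`, and `s(x)` acts on `E[2^J](χ_u)` by `u^{κ(s x)}·s(x)`);
  `2^J Q' = Σ_x u^{κ(s x)} s(x) (2^J Q)` is Kim's twisted norm of the layer point.

With w3 g13's `ResidualThetaLayer.PlusDual.twistedNorm_image_torsionBy_eq` (twisted norms of the layer classes `(A/2^J A)^{Γ_J}`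
exhaust the eigen-classes `(A/2^J A)^{g = u'}`) and the level-`0` dictionary (`exists_eigen_of_witness`,
`oneCocycleClass_eq_of_witness_sub_mem`) this is the cohomological half of COR-SURJ `L_u = cor(H_J)`.

References: B. D. Kim, Compositio Math. 143 (2007), Prop. 3.15 (proof, pp. 56–57), Prop. 4.11 (pp. 62–63) [BDKim2007];
J. Neukirch, A. Schmidt, K. Wingberg, *Cohomology of Number Fields* (2008), I §5 (cor on inhomogeneous cochains) [NeukirchSchmidtWingberg2008];
R. Greenberg, LNM 1716 (1999), §4 p. 124 [GreenbergLNM1716]; S. Kobayashi, Invent. math. 152 (2003), Def. 1.1 [Kobayashi2003].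
-/

-- the Theorems namespace of this sub repeats the summit name by design (D-0017 nested layout)
set_option linter.dupNamespace false

noncomputable section

open scoped Classical NumberField
open CategoryTheory Function Field NumberField IsDedekindDomain

namespace Summit.BirchSwinnertonDyer.BirchSwinnertonDyer.Theorems.SignedEC.TwistedLocalKummer

open Literature.NumberTheory.EllipticCurves Literature.NumberTheory.GaloisRepresentations WeierstrassCurve ZpExtension
  Literature.NumberTheory.EllipticCurves.Kobayashi2003 Literature.NumberTheory.EllipticCurves.Sprung2012
  Summit.BirchSwinnertonDyer.Rank1Residual.Additive SignedKatoOffTwo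
open Literature.NumberTheory.EllipticCurves (schreierElt schreierElt_coe coe_smul_quotient_eq)
open scoped ContRepresentation

universe u

variable (W : WeierstrassCurve ℚ) [W.IsElliptic]

/-! ## §1 On the layer `U_J` the twist is invisible -/

omit [W.IsElliptic] in
/-- `N = Gal(ℚ̄_v/ℚ_{v,∞}) ≤ U_J = Gal(ℚ̄_v/ℚ_{v,J})` (`ker κ ≤ κ⁻¹(2^J ℤ₂)`). [cite: Kobayashi2003, Def. 1.1] -/
theorem kerLocal_le_layerGroup (κ : ZpExtension ℚ 2) (v : HeightOneSpectrum (𝓞 ℚ)) (J : ℕ) :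
    localSubgroup κ.kerSubgroup (v.adicCompletion ℚ) ≤ LayerPairing.layerGroup κ v J :=
  fun _ hτ ↦ (mem_localSubgroupOfEmb_iff _ _ _).mpr (κ.kerSubgroup_le_layerSubgroup J ((mem_localSubgroup_iff _ _ _).mp hτ))

omit [W.IsElliptic] in
/-- **On `U_J` the twist `χ_u` is invisible on `E[2^J]`**: `σ ∈ U_J` acts on `E[2^J](χ_u)` by `res σ` alone
(`u^{κ(σ) mod 2^J} = u^0`). [cite: GreenbergLNM1716, §4 p. 124] [cite: BDKim2007, Prop. 4.11 (proof)] -/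
theorem twistedTorsion_restrictField_apply_of_mem_layerGroup (κ : ZpExtension ℚ 2) (J : ℕ) (u : ℤ) (hu : (2 : ℤ) ∣ u - 1)
    (v : HeightOneSpectrum (𝓞 ℚ)) {σ : absoluteGaloisGroup (v.adicCompletion ℚ)}
    (hσ : σ ∈ LayerPairing.layerGroup κ v J) (m : W.geomTorsion ((2 ^ J : ℕ) : ℤ)) :
    (W.twistedTorsionGaloisModule 2 κ J u hu).restrictField (v.adicCompletion ℚ) σ m =
      resGal (K := ℚ) (v.adicCompletion ℚ) σ • m := by
  have hσ' : resGal (K := ℚ) (v.adicCompletion ℚ) σ ∈ κ.layerSubgroup J := (mem_localSubgroupOfEmb_iff _ _ σ).mp hσ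
  change W.twistedTorsionGaloisModule 2 κ J u hu (resGal (K := ℚ) (v.adicCompletion ℚ) σ) m = _
  rw [ZpExtension.galoisTwist_apply_of_mem_layerSubgroup _ _ _ _ _ _ hσ', torsionGaloisModule_apply_apply]

omit [W.IsElliptic] in
/-- The untwisted local module: `σ ∈ Γ_{ℚ_v}` acts on `E[2^J]|` (`LayerPairing.torsionLocalRep`) by `res σ`. [cite: SilvermanAEC2009, X §4] -/
theorem torsionLocalRep_ρ_apply (J : ℕ) (v : HeightOneSpectrum (𝓞 ℚ)) (σ : absoluteGaloisGroup (v.adicCompletion ℚ))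
    (m : W.geomTorsion ((2 ^ J : ℕ) : ℤ)) :
    (LayerPairing.torsionLocalRep W (2 ^ J) v).ρ σ m = resGal (K := ℚ) (v.adicCompletion ℚ) σ • m := by
  change W.torsionGaloisModule ((2 ^ J : ℕ) : ℤ) (resGal (K := ℚ) (v.adicCompletion ℚ) σ) m = _
  rw [torsionGaloisModule_apply_apply]

omit [W.IsElliptic] in
/-- **Untwisting a layer cocycle**: every continuous `U_J`-cocycle of `M_u|` is (has the same values as) a continuous
`U_J`-cocycle of the untwisted `E[2^J]|`. [cite: BDKim2007, Prop. 4.11 (proof)] -/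
theorem exists_untwist_layerCocycle (κ : ZpExtension ℚ 2) (J : ℕ) (u : ℤ) (hu : (2 : ℤ) ∣ u - 1)
    (v : HeightOneSpectrum (𝓞 ℚ))
    (ψ : contOneCocycles (subgroupRep ((W.twistedTorsionGaloisModule 2 κ J u hu).restrictField (v.adicCompletion ℚ)).toTopRep
      (LayerPairing.layerGroup κ v J))) :
    ∃ ψ₀ : contOneCocycles (subgroupRep (LayerPairing.torsionLocalRep W (2 ^ J) v) (LayerPairing.layerGroup κ v J)),
      ∀ τ, ψ₀.1 τ = ψ.1 τ := by
  refine ⟨⟨ψ.1, fun a b ↦ ?_⟩, fun _ ↦ rfl⟩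
  have h := ψ.2 a b
  rw [subgroupRep_ρ_apply] at h ⊢
  rw [torsionLocalRep_ρ_apply]
  rw [h]
  change ψ.1 a + (W.twistedTorsionGaloisModule 2 κ J u hu).restrictField (v.adicCompletion ℚ) a (ψ.1 b) = _
  rw [twistedTorsion_restrictField_apply_of_mem_layerGroup W κ J u hu v a.2]

omit [W.IsElliptic] in
/-- **Twisting a layer cocycle**: conversely every continuous `U_J`-cocycle of `E[2^J]|` is a `U_J`-cocycle of `M_u|`.
[cite: BDKim2007, Prop. 4.11 (proof)] -/
theorem exists_twist_layerCocycle (κ : ZpExtension ℚ 2) (J : ℕ) (u : ℤ) (hu : (2 : ℤ) ∣ u - 1)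
    (v : HeightOneSpectrum (𝓞 ℚ))
    (ψ₀ : contOneCocycles (subgroupRep (LayerPairing.torsionLocalRep W (2 ^ J) v) (LayerPairing.layerGroup κ v J))) :
    ∃ ψ : contOneCocycles (subgroupRep ((W.twistedTorsionGaloisModule 2 κ J u hu).restrictField (v.adicCompletion ℚ)).toTopRep
      (LayerPairing.layerGroup κ v J)), ∀ τ, ψ.1 τ = ψ₀.1 τ := by
  refine ⟨⟨ψ₀.1, fun a b ↦ ?_⟩, fun _ ↦ rfl⟩
  have h := ψ₀.2 a b
  rw [subgroupRep_ρ_apply, torsionLocalRep_ρ_apply] at h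
  rw [subgroupRep_ρ_apply, h]
  change _ = ψ₀.1 a + (W.twistedTorsionGaloisModule 2 κ J u hu).restrictField (v.adicCompletion ℚ) a (ψ₀.1 b)
  rw [twistedTorsion_restrictField_apply_of_mem_layerGroup W κ J u hu v a.2]


/-! ## §2 Corestriction of a layer witness class: the twisted norm of the witness point -/

omit [W.IsElliptic] in
/-- `σ ∈ Γ_{ℚ_v}` acts on `E[2^J](χ_u)` by `u^{κ(σ) mod 2^J} · res σ`, read on points of `E(ℚ̄_v)`.
[cite: GreenbergLNM1716, §4 p. 124] -/
theorem pointsMap_twistedTorsion_restrictField_apply (κ : ZpExtension ℚ 2) (J : ℕ) (u : ℤ) (hu : (2 : ℤ) ∣ u - 1)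
    (v : HeightOneSpectrum (𝓞 ℚ)) (σ : absoluteGaloisGroup (v.adicCompletion ℚ)) (m : W.geomTorsion ((2 ^ J : ℕ) : ℤ)) :
    pointsMap W (v.adicCompletion ℚ)
        (((W.twistedTorsionGaloisModule 2 κ J u hu).restrictField (v.adicCompletion ℚ) σ m : W.geomTorsion ((2 ^ J : ℕ) : ℤ)) :
          W.geomPoints) =
      (u ^ κ.twistExponent J (resGal (K := ℚ) (v.adicCompletion ℚ) σ)) •
        (σ • pointsMap W (v.adicCompletion ℚ) (m : W.geomPoints)) := by
  change pointsMap W _ ((W.twistedTorsionGaloisModule 2 κ J u hu (resGal (K := ℚ) (v.adicCompletion ℚ) σ) m :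
    W.geomTorsion ((2 ^ J : ℕ) : ℤ)) : W.geomPoints) = _
  rw [ZpExtension.galoisTwist_apply_apply, torsionGaloisModule_apply_apply, AddSubgroupClass.coe_zsmul, map_zsmul,
    Literature.NumberTheory.EllipticCurves.AddSubgroup.torsionBy.coe_smul, pointsMap_smul]

omit [W.IsElliptic] in
/-- **The transfer of a layer witness cocycle has the twisted norm as witness point.** Let `ψ` be a continuous
`U_J`-cocycle of `M_u|` with an `A`-witness `Q` on `N` (`ψ(τ) = τQ − Q` on points, `τ ∈ N`). Then for every system `s`
of representatives of `Γ_{ℚ_v}/U_J` the transfer cocycle `cor_s ψ` satisfies, for `τ ∈ N`,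
`(cor_s ψ)(τ) = τQ' − Q'` on points with `Q' = Σ_x u^{κ(s x) mod 2^J} • s(x) • Q` — since `N ⊴ Γ_{ℚ_v}` fixes every coset,
the Schreier elements are `s(x)⁻¹ τ s(x) ∈ N` and `s(x)` acts through the twist by `u^{κ(s x)} s(x)`.
[cite: BDKim2007, Prop. 4.11 (proof, p. 63)] [cite: NeukirchSchmidtWingberg2008, I §5] -/
theorem pointsMap_transferCocycle_apply_of_layerWitness (κ : ZpExtension ℚ 2) (J : ℕ) (u : ℤ) (hu : (2 : ℤ) ∣ u - 1)
    (v : HeightOneSpectrum (𝓞 ℚ))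
    [Fintype (absoluteGaloisGroup (v.adicCompletion ℚ) ⧸ LayerPairing.layerGroup κ v J)]
    {s : absoluteGaloisGroup (v.adicCompletion ℚ) ⧸ LayerPairing.layerGroup κ v J → absoluteGaloisGroup (v.adicCompletion ℚ)}
    (hs : ∀ x, (s x : absoluteGaloisGroup (v.adicCompletion ℚ) ⧸ LayerPairing.layerGroup κ v J) = x)
    (ψ : contOneCocycles (subgroupRep ((W.twistedTorsionGaloisModule 2 κ J u hu).restrictField (v.adicCompletion ℚ)).toTopRep
      (LayerPairing.layerGroup κ v J)))
    (Q : localPoints W (v.adicCompletion ℚ))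
    (hψ : ∀ (τ : absoluteGaloisGroup (v.adicCompletion ℚ)) (hτ : τ ∈ localSubgroup κ.kerSubgroup (v.adicCompletion ℚ)),
      pointsMap W (v.adicCompletion ℚ) ((ψ.1 ⟨τ, kerLocal_le_layerGroup κ v J hτ⟩ : W.geomTorsion ((2 ^ J : ℕ) : ℤ)) :
        W.geomPoints) = τ • Q - Q)
    (τ : absoluteGaloisGroup (v.adicCompletion ℚ)) (hτ : τ ∈ localSubgroup κ.kerSubgroup (v.adicCompletion ℚ)) :
    pointsMap W (v.adicCompletion ℚ)
        (((transferCocycle ((W.twistedTorsionGaloisModule 2 κ J u hu).restrictField (v.adicCompletion ℚ)).toTopRep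
            (LayerPairing.layerGroup κ v J) (LayerPairing.isOpen_layerGroup κ v J) hs ψ).1 τ :
          W.geomTorsion ((2 ^ J : ℕ) : ℤ)) : W.geomPoints) =
      τ • (∑ x, (u ^ κ.twistExponent J (resGal (K := ℚ) (v.adicCompletion ℚ) (s x))) • (s x • Q)) -
        ∑ x, (u ^ κ.twistExponent J (resGal (K := ℚ) (v.adicCompletion ℚ) (s x))) • (s x • Q) := by
  haveI := LayerPairing.normal_layerGroup κ v J
  haveI : (localSubgroup κ.kerSubgroup (v.adicCompletion ℚ)).Normal := by
    rw [localSubgroup_eq_comap]; infer_instance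
  have galois_smul_zsmul : ∀ (g : absoluteGaloisGroup (v.adicCompletion ℚ)) (c : ℤ) (P : localPoints W (v.adicCompletion ℚ)),
      g • (c • P) = c • (g • P) := fun g c P ↦ map_zsmul (DistribSMul.toAddMonoidHom _ g) c P
  -- the Schreier elements of `τ ∈ N` are the conjugates `s(x)⁻¹ τ s(x)`
  have hτU : τ ∈ LayerPairing.layerGroup κ v J := kerLocal_le_layerGroup κ v J hτ
  have hfix : ∀ x : absoluteGaloisGroup (v.adicCompletion ℚ) ⧸ LayerPairing.layerGroup κ v J, τ • x = x := fun x ↦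
    coe_smul_quotient_eq (LayerPairing.layerGroup κ v J) ⟨τ, hτU⟩ x
  have hconj : ∀ x : absoluteGaloisGroup (v.adicCompletion ℚ) ⧸ LayerPairing.layerGroup κ v J,
      (s x)⁻¹ * τ * s x ∈ localSubgroup κ.kerSubgroup (v.adicCompletion ℚ) := fun x ↦ by
    have h := Subgroup.Normal.conj_mem (inferInstance : (localSubgroup κ.kerSubgroup (v.adicCompletion ℚ)).Normal) τ hτ (s x)⁻¹
    rwa [inv_inv] at h
  have hsch : ∀ x : absoluteGaloisGroup (v.adicCompletion ℚ) ⧸ LayerPairing.layerGroup κ v J,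
      schreierElt (LayerPairing.layerGroup κ v J) hs τ x = ⟨(s x)⁻¹ * τ * s x, kerLocal_le_layerGroup κ v J (hconj x)⟩ :=
    fun x ↦ Subtype.ext (by rw [schreierElt_coe, hfix])
  rw [transferCocycle_apply, transferFun_apply, AddSubmonoidClass.coe_finsetSum, map_sum, Finset.smul_sum,
    ← Finset.sum_sub_distrib]
  refine Finset.sum_congr rfl fun x _ ↦ ?_
  rw [hfix, hsch]
  change pointsMap W (v.adicCompletion ℚ) (((W.twistedTorsionGaloisModule 2 κ J u hu).restrictField (v.adicCompletion ℚ)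
    (s x) (ψ.1 ⟨(s x)⁻¹ * τ * s x, kerLocal_le_layerGroup κ v J (hconj x)⟩) : W.geomTorsion ((2 ^ J : ℕ) : ℤ)) : W.geomPoints) = _
  rw [pointsMap_twistedTorsion_restrictField_apply, hψ _ (hconj x), smul_sub, mul_smul, mul_smul, smul_inv_smul, smul_sub,
    galois_smul_zsmul]

omit [W.IsElliptic] in
/-- The twisted norm point `Q' = Σ_x u^{κ(s x)} • s(x) • Q` inherits `2^k Q ∈ A ⟹ 2^k Q' ∈ A` (`A` is `Γ_{ℚ_v}`-stable).
[cite: Kobayashi2003, Def. 1.1] -/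
theorem nsmul_twistedNormPoint_mem (κ : ZpExtension ℚ 2) (J : ℕ) (u : ℤ) (v : HeightOneSpectrum (𝓞 ℚ))
    [Fintype (absoluteGaloisGroup (v.adicCompletion ℚ) ⧸ LayerPairing.layerGroup κ v J)]
    (s : absoluteGaloisGroup (v.adicCompletion ℚ) ⧸ LayerPairing.layerGroup κ v J → absoluteGaloisGroup (v.adicCompletion ℚ))
    {Q : localPoints W (v.adicCompletion ℚ)} {k : ℕ}
    (hkQ : 2 ^ k • Q ∈ ⨆ n, signedLocalPoints κ (v.adicCompletion ℚ) W 1 n) :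
    2 ^ k • (∑ x, (u ^ κ.twistExponent J (resGal (K := ℚ) (v.adicCompletion ℚ) (s x))) • (s x • Q)) ∈
      ⨆ n, signedLocalPoints κ (v.adicCompletion ℚ) W 1 n := by
  have galois_smul_nsmul : ∀ (g : absoluteGaloisGroup (v.adicCompletion ℚ)) (c : ℕ) (P : localPoints W (v.adicCompletion ℚ)),
      g • (c • P) = c • (g • P) := fun g c P ↦ map_nsmul (DistribSMul.toAddMonoidHom _ g) c P
  rw [Finset.smul_sum]
  refine AddSubgroup.sum_mem _ fun x _ ↦ ?_
  rw [smul_comm, ← galois_smul_nsmul]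
  exact AddSubgroup.zsmul_mem _ (PlusDualTwo.smul_mem_iSup_signedLocalPoints W κ v (s x) hkQ) _

omit [W.IsElliptic] in
/-- **Corestriction from the layer lands in `L_u`.** For a continuous `U_J`-cocycle `ψ` of `M_u|_{Γ_{ℚ_v}}` with an
`A`-witness `(Q, k)` on `N` (`ψ(τ) = τQ − Q` on points for `τ ∈ N`, `2^k Q ∈ A`), `cor_{U_J}^{Γ_{ℚ_v}} [ψ] ∈ L_u` — witnessed by
`(cor_s ψ, Q', k)` with the twisted norm point `Q'`. Kim: «`Cor_𝔭(H^n_{𝔭,P}[𝔪^k]) ⊆ H^0_{𝔭,P}[𝔪^k]`».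
[cite: BDKim2007, Prop. 4.11 (proof, pp. 62–63)] [cite: Kobayashi2003, Def. 1.1] -/
theorem cores_mem_twistedTorsionLocalKummer_of_layerWitness (κ : ZpExtension ℚ 2) (J : ℕ) (u : ℤ) (hu : (2 : ℤ) ∣ u - 1)
    (v : HeightOneSpectrum (𝓞 ℚ))
    [Fintype (absoluteGaloisGroup (v.adicCompletion ℚ) ⧸ LayerPairing.layerGroup κ v J)]
    (ψ : contOneCocycles (subgroupRep ((W.twistedTorsionGaloisModule 2 κ J u hu).restrictField (v.adicCompletion ℚ)).toTopRep
      (LayerPairing.layerGroup κ v J)))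
    (Q : localPoints W (v.adicCompletion ℚ)) {k : ℕ} (hkQ : 2 ^ k • Q ∈ ⨆ n, signedLocalPoints κ (v.adicCompletion ℚ) W 1 n)
    (hψ : ∀ (τ : absoluteGaloisGroup (v.adicCompletion ℚ)) (hτ : τ ∈ localSubgroup κ.kerSubgroup (v.adicCompletion ℚ)),
      pointsMap W (v.adicCompletion ℚ) ((ψ.1 ⟨τ, kerLocal_le_layerGroup κ v J hτ⟩ : W.geomTorsion ((2 ^ J : ℕ) : ℤ)) :
        W.geomPoints) = τ • Q - Q) :
    cores ((W.twistedTorsionGaloisModule 2 κ J u hu).restrictField (v.adicCompletion ℚ)).toTopRep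
        (LayerPairing.layerGroup κ v J) (LayerPairing.isOpen_layerGroup κ v J) (oneCocycleClass _ ψ) ∈
      W.twistedTorsionLocalKummer 2 κ J u hu (v.adicCompletion ℚ) (⨆ n, signedLocalPoints κ (v.adicCompletion ℚ) W 1 n) := by
  obtain ⟨s, hs, -⟩ := exists_reps_one (LayerPairing.layerGroup κ v J)
  rw [cores_oneCocycleClass _ _ _ hs]
  exact (mem_twistedTorsionLocalKummer_iff _ _).mpr ⟨_, _, k, rfl, nsmul_twistedNormPoint_mem W κ J u v s hkQ,
    fun τ ↦ pointsMap_transferCocycle_apply_of_layerWitness W κ J u hu v hs ψ Q hψ τ τ.2⟩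

end Summit.BirchSwinnertonDyer.BirchSwinnertonDyer.Theorems.SignedEC.TwistedLocalKummer

end
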